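import Literature.Geometry.Riemannian.CutLocusBishopExp
import Literature.Geometry.Riemannian.SegmentsAreGeodesics
import Literature.Geometry.Riemannian.ExpMapGlobalSmooth
import Literature.Geometry.Riemannian.ExpMapHopfRinow
import HarnessLib

/-!
# Bishop 1977, density of the ordinary cut points: discharge of `bishop1977_ordinary_dense`

Final assembly of the proof of the named fact
`Literature.Geometry.Riemannian.bishop1977_ordinary_dense` of `CutLocusBishop.lean` (R. L. Bishop,
*Decomposition of cut loci*, Proc. AMS 65 (1977) 133–136, Main Theorem, first half: on a complete
connected Riemannian manifold the cut points of `p` joined to `p` by at least two minimal geodesics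
are dense in the cut locus of `p`; restated and reproved for closed subsets of Finsler manifolds
in Tanaka–Sabau, Houston J. Math. 42 (2016), Prop. 2.6). The tree's proof is the
invariance-of-domain argument of `CutLocusBishopDensity.lean` (`cutLocus_subset_closure_of_minVec`),
reduced in `CutLocusBishopExp.lean` (`bishop1977_ordinary_dense_of_hopfRinow`) to three classical
statements about a connected boundaryless Riemannian manifold whose closed distance balls are
compact, each of which is now a theorem of the tree:

* (i) unit-speed metric segments do not branch — `unitSpeed_segment_nonbranching`
  (`SegmentsAreGeodesics.lean`; Lee 2018, Thm. 6.4 with Cor. 6.12 and uniqueness of geodesics);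
* (ii) `exp_p : T_pM → M` is continuous — `contMDiff_riemannianExpMap`
  (`ExpMapGlobalSmooth.lean`; Lee 2018, Prop. 5.19);
* (iii) every `q` is `exp_p v` with `γ_v|[0,1]` minimizing — 
  `exists_isMinimizingUpTo_of_isGeodesicallyComplete` (`ExpMapHopfRinow.lean`; Lee 2018,
  Lemma 6.18 (a) / Cor. 6.21),

the Levi-Civita connection being geodesically complete because closed balls are compact
(`isGeodesicallyComplete_of_isCompact_closedBall`, `CutLocusBishopExp.lean`; Lee 2018, Thm. 6.19).
This file only assembles them; it lives apart from `CutLocusBishop.lean` because the proof files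
import that file. No definitions, no named facts (D-0026).

## References

* R. L. Bishop, *Decomposition of cut loci*, Proc. Amer. Math. Soc. 65 (1977) 133–136, Main
  Theorem (p. 133) and §4. [Bishop1977]
* J. M. Lee, *Introduction to Riemannian Manifolds*, 2nd ed., GTM 176 (2018): Prop. 5.19,
  Thm. 6.4, Cor. 6.12, Lemma 6.18, Thm. 6.19, Cor. 6.21, Prop. 10.32. [LeeRiemannianManifolds2018]
* M. Tanaka, S. V. Sabau, *The cut locus and distance function from a closed subset of a Finsler
  manifold*, Houston J. Math. 42 (2016) 1157–1197, Prop. 2.6 (arXiv:1207.0918).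
-/

noncomputable section

open Bundle Set Manifold
open scoped Manifold ContDiff Topology ENNReal NNReal

namespace Literature.Geometry.Riemannian

open Literature.Geometry.Lorentzian
open Literature.Geometry.Lorentzian.PseudoRiemannianMetric

/-- **Bishop 1977, Main Theorem (first half)** — discharge of the named fact
`bishop1977_ordinary_dense`: on a connected boundaryless `C^∞` Riemannian manifold whose closed
distance balls are compact, every cut point of `p` is a limit of cut points of `p` of
minimal-geodesic multiplicity `≥ 2`. By `bishop1977_ordinary_dense_of_hopfRinow` from
non-branching of segments (`unitSpeed_segment_nonbranching`), continuity of `exp_p`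
(`contMDiff_riemannianExpMap`) and the existence of minimizing `exp_p`-segments
(`exists_isMinimizingUpTo_of_isGeodesicallyComplete`), on the geodesically complete Levi-Civita
connection (`isGeodesicallyComplete_of_isCompact_closedBall`).
[cite: Bishop1977, Main Theorem (p. 133) and §4] -/
theorem bishop1977_ordinary_dense_holds : bishop1977_ordinary_dense := by
  refine bishop1977_ordinary_dense_of_hopfRinow ?_
  intro E _ _ _ _ H _ I _ M _ _ _ _ _ g _ _ hg hc
  have hcpl : IsGeodesicallyComplete g.leviCivita :=
    isGeodesicallyComplete_of_isCompact_closedBall hg hc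
  refine ⟨fun σ₁ σ₂ ℓ a b ha hab hb h₁ h₂ heq =>
      unitSpeed_segment_nonbranching g le_rfl hg hcpl σ₁ σ₂ ℓ a b ha hab hb h₁ h₂ heq,
    fun p => ⟨(contMDiff_riemannianExpMap g le_rfl hcpl p).continuous,
      fun q => exists_isMinimizingUpTo_of_isGeodesicallyComplete g le_rfl hg hcpl p q⟩⟩

end Literature.Geometry.Riemannian
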